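/-
Copyright: the b2b-balaban T⁴-continuum CRUX team, row NE7b OWNER lineage `t4-ne7b-p1` (gen 141). Project licence.
-/
import Summits.QuantumFields.BalabanUV.T4Continuum.Spine.NE7b.SupTiltedMomentPhiConstituent
import Summits.QuantumFields.BalabanUV.T4Continuum.Spine.NE7b.SupBlockDressedStep

/-!
# THE RAW FOURTH DERIVATIVE OF THE NEXT POTENTIAL ALONG A DIRECTION (SCOPING (d13)(2): the cumulant FORM of `∂⁴W`, fourth file; `U ∈ C⁴`).
# (472) wrote the third derivative as `T(ψ)[h,k,l] = Z⁻¹Φ_{hkl} + Z⁻²(G_hH_{kl} + G_kH_{hl} + H_{hk}G_l) + 2Z⁻³G_hG_kG_l` with scalar tilted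
# moments; (514)∕(515) differentiated every constituent (`Z′m = −G_m`, `G_v′m = ∫e^{−U}(U″mv − U′vU′m)`, `H_{vw}′m`,
# `Φ_{hkl}′m = ∫e^{−U}Ψ_{hklm}`).  Here:
# the product∕quotient rule on that combination along the line `s ↦ ψ₀ + s•m` — an ABSTRACT lemma for eight real functions, then its
# instantiation: for directions `h, k, l` of norm `≤ 1` and ANY `m`, at EVERY `ψ₀`,
#   `d∕ds|₀ T(ψ₀+sm)[h,k,l] = Z⁻¹Φ′ + Z⁻²G_mΦ + Z⁻²Σ(G′H + GH′) + 2Z⁻³G_mΣGH + 2Z⁻³Σ G′GG + 6Z⁻⁴G_mGGG`   (all at `ψ₀`, primes = `m`-derivatives)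
# — the raw (uncentred) fourth derivative `∂⁴W(ψ₀)[h,k,l,m]` of `W = −log Z` as an explicit polynomial in scalar tilted moments, for a general
# `Γ ⪰ 0` under the regulator (row NE7b, node U5c; (514), (515), (410) `block_Z_pos` BY NAME; [folklore])

Cell `pub-balaban`, sub-cell `t4`, spine estimate NE7b (`T4WeightBudget.RelWeightBound`; the cell's OWN estimate — NOT PRINTED in
[Bałaban 1983–89], NOT PROVED).  Crux-route work under `Spine/NE7b/` by the row OWNER (`t4-ne7b-p1` gen 141, file (516)) under FREEZE
(0)'s crux-prover clause; NOTHING of Bałaban's is named as a Lean object, valued or asserted; no `T4Continuum/Support` leaf typed; no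
`def`, no notation; zero `sorry`.  Imports (BY NAME): the OWNER's (515) `…SupTiltedMomentPhiConstituent` (`hasFDerivAt_Phi_scalar`,
`Phi_fderiv_apply`; through it (514) `hasFDerivAt_Z_scalar`, `Z_fderiv_apply`, `hasFDerivAt_G_scalar`, `G_fderiv_apply`, `hasFDerivAt_H_scalar`,
`H_fderiv_apply`), (410) `…SupBlockDressedStep` (`block_Z_pos`).

WHAT IS PROVED ([folklore]):
* §1 `hasDerivAt_third_form_combination` (eight abstract real functions; `field_simp` + `ring`), `hasDerivAt_along_line`.
* §2 THE END **`hasDerivAt_third_form_line`** (the display, every constituent a written-out scalar tilted integral); §3 toy.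

HONEST (what this is NOT).  The RAW fourth derivative; its regrouping into the CUMULANT form (average + four `Cov(U‴,U′)` + three `Cov(U″,U″)` +
six `κ₃(U″,U′,U′)` + `κ₄`), the identification with (419)'s `T` through (472) `hessW_deriv_apply`, and the assembly of the order-4 kernel letter
from (500)–(512) are the next files; the Fréchet repackaging (the output is `C⁴`) after them.  Scalar skeleton ((A3), NC-NE7b-α UNRULED); nothing
of Bałaban's asserted.  BY-NAME EFFECT ON THE WALL: NONE.  NE7b NOT PRINTED ∕ NOT PROVED; spine PROVED 0∕9; rung (B)+1 — the programme's
measures remain FINITE-torus statements; NOT the mass gap, NOT Clay.  HONEST DEPENDENCY: continuum YM on T⁴ ⇐ BetaPertH ∧ nine spine estimates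
(0∕9 proved); BetaPertH ⇐ (D1) ∧ (D4) ∧ CAP+tail; G-an2-4 gates asym, D1 and NE2∕3∕4.
-/

set_option autoImplicit false
set_option maxSynthPendingDepth 3

noncomputable section

namespace Summit.QuantumFields.BalabanUV.T4Continuum.NE7b.SupFourthDerivativeRaw

open MeasureTheory ProbabilityTheory Finset Real Metric Filter
open scoped BigOperators Topology
open SupTiltedMomentConstituents (hasFDerivAt_Z_scalar Z_fderiv_apply hasFDerivAt_G_scalar G_fderiv_apply hasFDerivAt_H_scalar H_fderiv_apply)
open SupTiltedMomentPhiConstituent (hasFDerivAt_Phi_scalar Phi_fderiv_apply)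
open SupBlockDressedStep (block_Z_pos)

variable {ι : Type} [Fintype ι] [DecidableEq ι]

/-! ## §1. The abstract combination and the line -/

omit [Fintype ι] [DecidableEq ι] in
/-- **The product∕quotient rule on `z⁻¹φ + z⁻²(g_h h_kl + g_k h_hl + h_hk g_l) + 2z⁻³g_hg_kg_l`** for eight real functions with derivatives at `s₀`
(`z(s₀) ≠ 0`). [folklore] -/
theorem hasDerivAt_third_form_combination {z gh gk gl hkl hhl hhk φ : ℝ → ℝ} {zd ghd gkd gld hkld hhld hhkd φd s₀ : ℝ}
    (hz : HasDerivAt z zd s₀) (hgh : HasDerivAt gh ghd s₀) (hgk : HasDerivAt gk gkd s₀) (hgl : HasDerivAt gl gld s₀)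
    (hhkl : HasDerivAt hkl hkld s₀) (hhhl : HasDerivAt hhl hhld s₀) (hhhk : HasDerivAt hhk hhkd s₀) (hφ : HasDerivAt φ φd s₀) (hz0 : z s₀ ≠ 0) :
    HasDerivAt (fun s => (z s)⁻¹ * φ s + (z s ^ 2)⁻¹ * gh s * hkl s + (z s ^ 2)⁻¹ * gk s * hhl s + ((z s ^ 2)⁻¹ * hhk s + -2 / z s ^ 3 * -gh s * gk
        s) * gl s)
      ((z s₀)⁻¹ * φd - zd * (z s₀ ^ 2)⁻¹ * φ s₀ +
        ((z s₀ ^ 2)⁻¹ * (ghd * hkl s₀ + gh s₀ * hkld) - 2 * zd * (z s₀ ^ 3)⁻¹ * (gh s₀ * hkl s₀)) +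
        ((z s₀ ^ 2)⁻¹ * (gkd * hhl s₀ + gk s₀ * hhld) - 2 * zd * (z s₀ ^ 3)⁻¹ * (gk s₀ * hhl s₀)) +
        ((z s₀ ^ 2)⁻¹ * (hhkd * gl s₀ + hhk s₀ * gld) - 2 * zd * (z s₀ ^ 3)⁻¹ * (hhk s₀ * gl s₀)) +
        (2 * (z s₀ ^ 3)⁻¹ * (ghd * gk s₀ * gl s₀ + gh s₀ * gkd * gl s₀ + gh s₀ * gk s₀ * gld) - 6 * zd * (z s₀ ^ 4)⁻¹ * (gh s₀ * gk s₀ * gl s₀))) s₀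
            := by
  have h2 : z s₀ ^ 2 ≠ 0 := pow_ne_zero 2 hz0
  have h3 : z s₀ ^ 3 ≠ 0 := pow_ne_zero 3 hz0
  have t1 := (hz.inv hz0).mul hφ
  have t2 := (((hz.pow 2).inv h2).mul hgh).mul hhkl
  have t3 := (((hz.pow 2).inv h2).mul hgk).mul hhhl
  have t5 := ((((hz.pow 2).inv h2).mul hhhk).add ((((hasDerivAt_const s₀ (-2 : ℝ)).div (hz.pow 3) h3).mul hgh.neg).mul hgk)).mul hgl
  have hraw := ((t1.add t2).add t3).add t5
  refine hraw.congr_deriv ?_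
  simp only [Pi.inv_apply, Pi.pow_apply, Pi.mul_apply, Pi.add_apply, Pi.neg_apply, Pi.div_apply, Nat.cast_ofNat]
  field_simp
  ring

omit [DecidableEq ι] in
/-- **Along the line**: `HasFDerivAt F D ψ₀ ⟹ HasDerivAt (s ↦ F(ψ₀ + s•m)) (D m) 0`. [folklore] -/
theorem hasDerivAt_along_line {F : EuclideanSpace ℝ ι → ℝ} {D : EuclideanSpace ℝ ι →L[ℝ] ℝ} {ψ₀ : EuclideanSpace ℝ ι} (hF : HasFDerivAt F D ψ₀)
    (m : EuclideanSpace ℝ ι) : HasDerivAt (fun s : ℝ => F (ψ₀ + s • m)) (D m) 0 := by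
  have hL : HasDerivAt (fun s : ℝ => ψ₀ + s • m) m 0 := by
    simpa using ((hasDerivAt_id (0 : ℝ)).smul_const m).const_add ψ₀
  have hF' : HasFDerivAt F D (ψ₀ + (0 : ℝ) • m) := by rw [zero_smul, add_zero]; exact hF
  have h := hF'.comp_hasDerivAt (0 : ℝ) hL
  simpa [Function.comp_def] using h

/-! ## §2. THE END: the raw fourth derivative along a direction -/

section TheEnd

variable {Γ : Matrix ι ι ℝ} {γop : ℝ} {U : EuclideanSpace ℝ ι → ℝ} {U' : EuclideanSpace ℝ ι → EuclideanSpace ℝ ι →L[ℝ] ℝ}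
  {U'' : EuclideanSpace ℝ ι → EuclideanSpace ℝ ι →L[ℝ] EuclideanSpace ℝ ι →L[ℝ] ℝ}
  {U₃ : EuclideanSpace ℝ ι → EuclideanSpace ℝ ι →L[ℝ] EuclideanSpace ℝ ι →L[ℝ] EuclideanSpace ℝ ι →L[ℝ] ℝ}
  {U₄ : EuclideanSpace ℝ ι → EuclideanSpace ℝ ι →L[ℝ] EuclideanSpace ℝ ι →L[ℝ] EuclideanSpace ℝ ι →L[ℝ] EuclideanSpace ℝ ι →L[ℝ] ℝ}
  {κ₀ κ₁ κ₂ κ₃ κ₄ a τ δ θ : ℝ} {h k l : EuclideanSpace ℝ ι}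

/-- **THE END — THE RAW FOURTH DERIVATIVE OF `W = −log Z` ALONG `m`**: `d∕ds|₀` of (472)'s scalar `T(ψ₀+sm)[h,k,l]` equals the explicit
polynomial in the scalar tilted moments displayed below (every integral against `e^{−U(ω+ψ₀)}dN(0,Γ)`). [folklore] -/
theorem hasDerivAt_third_form_line (hΓ : Γ.PosSemidef) (hΓop : (γop • (1 : Matrix ι ι ℝ) - Γ).PosSemidef) (Y : Finset ι)
    (hUd : ∀ φ : EuclideanSpace ℝ ι, HasFDerivAt U (U' φ) φ) (hU'd : ∀ φ : EuclideanSpace ℝ ι, HasFDerivAt U' (U'' φ) φ)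
    (hU''d : ∀ φ : EuclideanSpace ℝ ι, HasFDerivAt U'' (U₃ φ) φ) (hU₃d : ∀ φ : EuclideanSpace ℝ ι, HasFDerivAt U₃ (U₄ φ) φ) (hU₄c : Continuous U₄)
    (hκ₀ : 0 ≤ κ₀) (hκ₁ : 0 ≤ κ₁) (ha : 0 ≤ a) (hτ : 0 < τ) (hδ : 0 < δ) (hθ1 : θ < 1) (hκθ : (2 * κ₀ * (1 + τ) + 4 * δ) * γop ≤ θ)
    (hstab : ∀ φ : EuclideanSpace ℝ ι, -(κ₀ * ∑ x ∈ Y, φ x ^ 2) ≤ U φ) (hU'b : ∀ φ : EuclideanSpace ℝ ι, ‖U' φ‖ ≤ κ₁ * (a + ∑ x ∈ Y, φ x ^ 2)) (hθ0 :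
        0 < θ) (hU''b : ∀ φ : EuclideanSpace ℝ ι, ‖U'' φ‖ ≤ κ₂) (hU₃b : ∀ φ : EuclideanSpace ℝ ι, ‖U₃ φ‖ ≤ κ₃)
    (hU₄b : ∀ φ : EuclideanSpace ℝ ι, ‖U₄ φ‖ ≤ κ₄) (ψ₀ : EuclideanSpace ℝ ι) (hh : ‖h‖ ≤ 1) (hk : ‖k‖ ≤ 1) (hl : ‖l‖ ≤ 1) (m : EuclideanSpace ℝ ι) :
    HasDerivAt (fun s : ℝ => ((∫ ω : EuclideanSpace ℝ ι, exp (-U (ω + (ψ₀ + s • m))) ∂(multivariateGaussian 0 Γ)))⁻¹ * (∫ ω : EuclideanSpace ℝ ι, exp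
        (-U (ω + (ψ₀ + s • m))) * (U₃ (ω + (ψ₀ + s • m)) h k l - U' (ω + (ψ₀ + s • m)) k * U'' (ω + (ψ₀ + s • m)) h l - U'' (ω + (ψ₀ + s • m)) h k *
        U' (ω + (ψ₀ + s • m)) l - U' (ω + (ψ₀ + s • m)) h * U'' (ω + (ψ₀ + s • m)) k l + U' (ω + (ψ₀ + s • m)) h * U' (ω + (ψ₀ + s • m)) k * U' (ω +
        (ψ₀ + s • m)) l) ∂(multivariateGaussian 0 Γ)) + ((∫ ω : EuclideanSpace ℝ ι, exp (-U (ω + (ψ₀ + s • m))) ∂(multivariateGaussian 0 Γ)) ^ 2)⁻¹ *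
        (∫ ω : EuclideanSpace ℝ ι, exp (-U (ω + (ψ₀ + s • m))) * U' (ω + (ψ₀ + s • m)) h ∂(multivariateGaussian 0 Γ)) * (∫ ω : EuclideanSpace ℝ ι,
        exp (-U (ω + (ψ₀ + s • m))) * (U'' (ω + (ψ₀ + s • m)) k l - U' (ω + (ψ₀ + s • m)) k * U' (ω + (ψ₀ + s • m)) l) ∂(multivariateGaussian 0 Γ)) +
        ((∫ ω : EuclideanSpace ℝ ι, exp (-U (ω + (ψ₀ + s • m))) ∂(multivariateGaussian 0 Γ)) ^ 2)⁻¹ * (∫ ω : EuclideanSpace ℝ ι, exp (-U (ω + (ψ₀ + s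
        • m))) * U' (ω + (ψ₀ + s • m)) k ∂(multivariateGaussian 0 Γ)) * (∫ ω : EuclideanSpace ℝ ι, exp (-U (ω + (ψ₀ + s • m))) * (U'' (ω + (ψ₀ + s •
        m)) h l - U' (ω + (ψ₀ + s • m)) h * U' (ω + (ψ₀ + s • m)) l) ∂(multivariateGaussian 0 Γ)) +
      (((∫ ω : EuclideanSpace ℝ ι, exp (-U (ω + (ψ₀ + s • m))) ∂(multivariateGaussian 0 Γ)) ^ 2)⁻¹ * (∫ ω : EuclideanSpace ℝ ι, exp (-U (ω + (ψ₀ + s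
          • m))) * (U'' (ω + (ψ₀ + s • m)) h k - U' (ω + (ψ₀ + s • m)) h * U' (ω + (ψ₀ + s • m)) k) ∂(multivariateGaussian 0 Γ)) + -2 / (∫ ω :
          EuclideanSpace ℝ ι, exp (-U (ω + (ψ₀ + s • m))) ∂(multivariateGaussian 0 Γ)) ^ 3 * -(∫ ω : EuclideanSpace ℝ ι, exp (-U (ω + (ψ₀ + s • m)))
          * U' (ω + (ψ₀ + s • m)) h ∂(multivariateGaussian 0 Γ)) * (∫ ω : EuclideanSpace ℝ ι, exp (-U (ω + (ψ₀ + s • m))) * U' (ω + (ψ₀ + s • m)) k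
          ∂(multivariateGaussian 0 Γ))) * (∫ ω : EuclideanSpace ℝ ι, exp (-U (ω + (ψ₀ + s • m))) * U' (ω + (ψ₀ + s • m)) l ∂(multivariateGaussian 0
          Γ)))
      (((∫ ω : EuclideanSpace ℝ ι, exp (-U (ω + ψ₀)) ∂(multivariateGaussian 0 Γ)))⁻¹ * (∫ ω : EuclideanSpace ℝ ι, exp (-U (ω + ψ₀)) * (U₄ (ω + ψ₀) m
          h k l - U' (ω + ψ₀) k * U₃ (ω + ψ₀) m h l - U'' (ω + ψ₀) h l * U'' (ω + ψ₀) m k - U'' (ω + ψ₀) h k * U'' (ω + ψ₀) m l - U' (ω + ψ₀) l * U₃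
          (ω + ψ₀) m h k -
        U' (ω + ψ₀) h * U₃ (ω + ψ₀) m k l - U'' (ω + ψ₀) k l * U'' (ω + ψ₀) m h + U' (ω + ψ₀) h * U' (ω + ψ₀) k * U'' (ω + ψ₀) m l + U' (ω + ψ₀) h *
            U' (ω + ψ₀) l * U'' (ω + ψ₀) m k +
        U' (ω + ψ₀) k * U' (ω + ψ₀) l * U'' (ω + ψ₀) m h - (U₃ (ω + ψ₀) h k l - U' (ω + ψ₀) k * U'' (ω + ψ₀) h l - U'' (ω + ψ₀) h k * U' (ω + ψ₀) l -
            U' (ω + ψ₀) h * U'' (ω + ψ₀) k l + U' (ω + ψ₀) h * U' (ω + ψ₀) k * U' (ω + ψ₀) l) * U' (ω + ψ₀) m) ∂(multivariateGaussian 0 Γ)) - -(∫ ω :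
            EuclideanSpace ℝ ι, exp (-U (ω + ψ₀)) * U' (ω + ψ₀) m ∂(multivariateGaussian 0 Γ)) * ((∫ ω : EuclideanSpace ℝ ι, exp (-U (ω + ψ₀))
            ∂(multivariateGaussian 0 Γ)) ^ 2)⁻¹ * (∫ ω : EuclideanSpace ℝ ι, exp (-U (ω + ψ₀)) * (U₃ (ω + ψ₀) h k l - U' (ω + ψ₀) k * U'' (ω + ψ₀) h
            l - U'' (ω + ψ₀) h k * U' (ω + ψ₀) l - U' (ω + ψ₀) h * U'' (ω + ψ₀) k l + U' (ω + ψ₀) h * U' (ω + ψ₀) k * U' (ω + ψ₀) l)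
            ∂(multivariateGaussian 0 Γ)) +
        (((∫ ω : EuclideanSpace ℝ ι, exp (-U (ω + ψ₀)) ∂(multivariateGaussian 0 Γ)) ^ 2)⁻¹ * ((∫ ω : EuclideanSpace ℝ ι, exp (-U (ω + ψ₀)) * (U'' (ω
            + ψ₀) m h - U' (ω + ψ₀) h * U' (ω + ψ₀) m) ∂(multivariateGaussian 0 Γ)) * (∫ ω : EuclideanSpace ℝ ι, exp (-U (ω + ψ₀)) * (U'' (ω + ψ₀) k
            l - U' (ω + ψ₀) k * U' (ω + ψ₀) l) ∂(multivariateGaussian 0 Γ)) + (∫ ω : EuclideanSpace ℝ ι, exp (-U (ω + ψ₀)) * U' (ω + ψ₀) h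
            ∂(multivariateGaussian 0 Γ)) * (∫ ω : EuclideanSpace ℝ ι, exp (-U (ω + ψ₀)) * (U₃ (ω + ψ₀) m k l - U' (ω + ψ₀) k * U'' (ω + ψ₀) m l - U'
            (ω + ψ₀) l * U'' (ω + ψ₀) m k -
        (U'' (ω + ψ₀) k l - U' (ω + ψ₀) k * U' (ω + ψ₀) l) * U' (ω + ψ₀) m) ∂(multivariateGaussian 0 Γ))) - 2 * -(∫ ω : EuclideanSpace ℝ ι, exp (-U
            (ω + ψ₀)) * U' (ω + ψ₀) m ∂(multivariateGaussian 0 Γ)) * ((∫ ω : EuclideanSpace ℝ ι, exp (-U (ω + ψ₀)) ∂(multivariateGaussian 0 Γ)) ^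
            3)⁻¹ * ((∫ ω : EuclideanSpace ℝ ι, exp (-U (ω + ψ₀)) * U' (ω + ψ₀) h ∂(multivariateGaussian 0 Γ)) * (∫ ω : EuclideanSpace ℝ ι, exp (-U (ω
            + ψ₀)) * (U'' (ω + ψ₀) k l - U' (ω + ψ₀) k * U' (ω + ψ₀) l) ∂(multivariateGaussian 0 Γ)))) +
        (((∫ ω : EuclideanSpace ℝ ι, exp (-U (ω + ψ₀)) ∂(multivariateGaussian 0 Γ)) ^ 2)⁻¹ * ((∫ ω : EuclideanSpace ℝ ι, exp (-U (ω + ψ₀)) * (U'' (ω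
            + ψ₀) m k - U' (ω + ψ₀) k * U' (ω + ψ₀) m) ∂(multivariateGaussian 0 Γ)) * (∫ ω : EuclideanSpace ℝ ι, exp (-U (ω + ψ₀)) * (U'' (ω + ψ₀) h
            l - U' (ω + ψ₀) h * U' (ω + ψ₀) l) ∂(multivariateGaussian 0 Γ)) + (∫ ω : EuclideanSpace ℝ ι, exp (-U (ω + ψ₀)) * U' (ω + ψ₀) k
            ∂(multivariateGaussian 0 Γ)) * (∫ ω : EuclideanSpace ℝ ι, exp (-U (ω + ψ₀)) * (U₃ (ω + ψ₀) m h l - U' (ω + ψ₀) h * U'' (ω + ψ₀) m l - U'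
            (ω + ψ₀) l * U'' (ω + ψ₀) m h -
        (U'' (ω + ψ₀) h l - U' (ω + ψ₀) h * U' (ω + ψ₀) l) * U' (ω + ψ₀) m) ∂(multivariateGaussian 0 Γ))) - 2 * -(∫ ω : EuclideanSpace ℝ ι, exp (-U
            (ω + ψ₀)) * U' (ω + ψ₀) m ∂(multivariateGaussian 0 Γ)) * ((∫ ω : EuclideanSpace ℝ ι, exp (-U (ω + ψ₀)) ∂(multivariateGaussian 0 Γ)) ^
            3)⁻¹ * ((∫ ω : EuclideanSpace ℝ ι, exp (-U (ω + ψ₀)) * U' (ω + ψ₀) k ∂(multivariateGaussian 0 Γ)) * (∫ ω : EuclideanSpace ℝ ι, exp (-U (ω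
            + ψ₀)) * (U'' (ω + ψ₀) h l - U' (ω + ψ₀) h * U' (ω + ψ₀) l) ∂(multivariateGaussian 0 Γ)))) +
        (((∫ ω : EuclideanSpace ℝ ι, exp (-U (ω + ψ₀)) ∂(multivariateGaussian 0 Γ)) ^ 2)⁻¹ * ((∫ ω : EuclideanSpace ℝ ι, exp (-U (ω + ψ₀)) * (U₃ (ω +
            ψ₀) m h k - U' (ω + ψ₀) h * U'' (ω + ψ₀) m k - U' (ω + ψ₀) k * U'' (ω + ψ₀) m h -
        (U'' (ω + ψ₀) h k - U' (ω + ψ₀) h * U' (ω + ψ₀) k) * U' (ω + ψ₀) m) ∂(multivariateGaussian 0 Γ)) * (∫ ω : EuclideanSpace ℝ ι, exp (-U (ω +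
            ψ₀)) * U' (ω + ψ₀) l ∂(multivariateGaussian 0 Γ)) + (∫ ω : EuclideanSpace ℝ ι, exp (-U (ω + ψ₀)) * (U'' (ω + ψ₀) h k - U' (ω + ψ₀) h * U'
            (ω + ψ₀) k) ∂(multivariateGaussian 0 Γ)) * (∫ ω : EuclideanSpace ℝ ι, exp (-U (ω + ψ₀)) * (U'' (ω + ψ₀) m l - U' (ω + ψ₀) l * U' (ω + ψ₀)
            m) ∂(multivariateGaussian 0 Γ))) - 2 * -(∫ ω : EuclideanSpace ℝ ι, exp (-U (ω + ψ₀)) * U' (ω + ψ₀) m ∂(multivariateGaussian 0 Γ)) * ((∫ ω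
            : EuclideanSpace ℝ ι, exp (-U (ω + ψ₀)) ∂(multivariateGaussian 0 Γ)) ^ 3)⁻¹ * ((∫ ω : EuclideanSpace ℝ ι, exp (-U (ω + ψ₀)) * (U'' (ω +
            ψ₀) h k - U' (ω + ψ₀) h * U' (ω + ψ₀) k) ∂(multivariateGaussian 0 Γ)) * (∫ ω : EuclideanSpace ℝ ι, exp (-U (ω + ψ₀)) * U' (ω + ψ₀) l
            ∂(multivariateGaussian 0 Γ)))) +
        (2 * ((∫ ω : EuclideanSpace ℝ ι, exp (-U (ω + ψ₀)) ∂(multivariateGaussian 0 Γ)) ^ 3)⁻¹ * ((∫ ω : EuclideanSpace ℝ ι, exp (-U (ω + ψ₀)) * (U''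
            (ω + ψ₀) m h - U' (ω + ψ₀) h * U' (ω + ψ₀) m) ∂(multivariateGaussian 0 Γ)) * (∫ ω : EuclideanSpace ℝ ι, exp (-U (ω + ψ₀)) * U' (ω + ψ₀) k
            ∂(multivariateGaussian 0 Γ)) * (∫ ω : EuclideanSpace ℝ ι, exp (-U (ω + ψ₀)) * U' (ω + ψ₀) l ∂(multivariateGaussian 0 Γ)) + (∫ ω :
            EuclideanSpace ℝ ι, exp (-U (ω + ψ₀)) * U' (ω + ψ₀) h ∂(multivariateGaussian 0 Γ)) * (∫ ω : EuclideanSpace ℝ ι, exp (-U (ω + ψ₀)) * (U''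
            (ω + ψ₀) m k - U' (ω + ψ₀) k * U' (ω + ψ₀) m) ∂(multivariateGaussian 0 Γ)) * (∫ ω : EuclideanSpace ℝ ι, exp (-U (ω + ψ₀)) * U' (ω + ψ₀) l
            ∂(multivariateGaussian 0 Γ)) + (∫ ω : EuclideanSpace ℝ ι, exp (-U (ω + ψ₀)) * U' (ω + ψ₀) h ∂(multivariateGaussian 0 Γ)) * (∫ ω :
            EuclideanSpace ℝ ι, exp (-U (ω + ψ₀)) * U' (ω + ψ₀) k ∂(multivariateGaussian 0 Γ)) * (∫ ω : EuclideanSpace ℝ ι, exp (-U (ω + ψ₀)) * (U''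
            (ω + ψ₀) m l - U' (ω + ψ₀) l * U' (ω + ψ₀) m) ∂(multivariateGaussian 0 Γ))) -
          6 * -(∫ ω : EuclideanSpace ℝ ι, exp (-U (ω + ψ₀)) * U' (ω + ψ₀) m ∂(multivariateGaussian 0 Γ)) * ((∫ ω : EuclideanSpace ℝ ι, exp (-U (ω +
              ψ₀)) ∂(multivariateGaussian 0 Γ)) ^ 4)⁻¹ * ((∫ ω : EuclideanSpace ℝ ι, exp (-U (ω + ψ₀)) * U' (ω + ψ₀) h ∂(multivariateGaussian 0 Γ)) *
              (∫ ω : EuclideanSpace ℝ ι, exp (-U (ω + ψ₀)) * U' (ω + ψ₀) k ∂(multivariateGaussian 0 Γ)) * (∫ ω : EuclideanSpace ℝ ι, exp (-U (ω +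
              ψ₀)) * U' (ω + ψ₀) l ∂(multivariateGaussian 0 Γ))))) 0 := by
  have hU'c : Continuous U' := continuous_iff_continuousAt.2 fun φ => (hU'd φ).continuousAt
  have hU''c : Continuous U'' := continuous_iff_continuousAt.2 fun φ => (hU''d φ).continuousAt
  have hU₃c : Continuous U₃ := continuous_iff_continuousAt.2 fun φ => (hU₃d φ).continuousAt
  have hz0 : (∫ ω : EuclideanSpace ℝ ι, exp (-U (ω + ψ₀)) ∂(multivariateGaussian 0 Γ)) ≠ 0 := (block_Z_pos hΓ hΓop Y hUd hκ₀ hτ hδ hθ0 hθ1 hκθ hstab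
      ψ₀).ne'
  -- the eight line derivatives ((514), (515))
  have hZ1 := hasFDerivAt_Z_scalar hΓ hΓop Y hUd hU'c hκ₀ hκ₁ ha hτ hδ hθ1 hκθ hstab hU'b ψ₀
  have hZ : HasFDerivAt (fun ψ : EuclideanSpace ℝ ι => ∫ ω : EuclideanSpace ℝ ι, exp (-U (ω + ψ)) ∂(multivariateGaussian 0 Γ))
      (∫ ω : EuclideanSpace ℝ ι, exp (-U (ω + ψ₀)) • ((0 : EuclideanSpace ℝ ι →L[ℝ] ℝ) - (1 : ℝ) • U' (ω + ψ₀)) ∂(multivariateGaussian 0 Γ)) ψ₀ := by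
    simpa only [mul_one] using hZ1
  have hz := (hasDerivAt_along_line hZ m).congr_deriv (Z_fderiv_apply hΓ hΓop Y hUd hU'c hκ₀ hκ₁ ha hτ hδ hθ1 hκθ hstab hU'b ψ₀ m)
  have hgh := (hasDerivAt_along_line (hasFDerivAt_G_scalar hΓ hΓop Y hUd hU'd hU''c hκ₀ hκ₁ ha hτ hδ hθ1 hκθ hstab hU'b hU''b ψ₀ h hh) m).congr_deriv
    (G_fderiv_apply hΓ hΓop Y hUd hU'd hU''c hκ₀ hκ₁ ha hτ hδ hθ1 hκθ hstab hU'b hU''b ψ₀ h hh m)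
  have hgk := (hasDerivAt_along_line (hasFDerivAt_G_scalar hΓ hΓop Y hUd hU'd hU''c hκ₀ hκ₁ ha hτ hδ hθ1 hκθ hstab hU'b hU''b ψ₀ k hk) m).congr_deriv
    (G_fderiv_apply hΓ hΓop Y hUd hU'd hU''c hκ₀ hκ₁ ha hτ hδ hθ1 hκθ hstab hU'b hU''b ψ₀ k hk m)
  have hgl := (hasDerivAt_along_line (hasFDerivAt_G_scalar hΓ hΓop Y hUd hU'd hU''c hκ₀ hκ₁ ha hτ hδ hθ1 hκθ hstab hU'b hU''b ψ₀ l hl) m).congr_deriv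
    (G_fderiv_apply hΓ hΓop Y hUd hU'd hU''c hκ₀ hκ₁ ha hτ hδ hθ1 hκθ hstab hU'b hU''b ψ₀ l hl m)
  have hhkl := (hasDerivAt_along_line (hasFDerivAt_H_scalar hΓ hΓop Y hUd hU'd hU''d hU₃c hκ₀ hκ₁ ha hτ hδ hθ1 hκθ hstab hU'b hU''b hU₃b ψ₀ k l hk
      hl) m).congr_deriv
    (H_fderiv_apply hΓ hΓop Y hUd hU'd hU''d hU₃c hκ₀ hκ₁ ha hτ hδ hθ1 hκθ hstab hU'b hU''b hU₃b ψ₀ k l hk hl m)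
  have hhhl := (hasDerivAt_along_line (hasFDerivAt_H_scalar hΓ hΓop Y hUd hU'd hU''d hU₃c hκ₀ hκ₁ ha hτ hδ hθ1 hκθ hstab hU'b hU''b hU₃b ψ₀ h l hh
      hl) m).congr_deriv
    (H_fderiv_apply hΓ hΓop Y hUd hU'd hU''d hU₃c hκ₀ hκ₁ ha hτ hδ hθ1 hκθ hstab hU'b hU''b hU₃b ψ₀ h l hh hl m)
  have hhhk := (hasDerivAt_along_line (hasFDerivAt_H_scalar hΓ hΓop Y hUd hU'd hU''d hU₃c hκ₀ hκ₁ ha hτ hδ hθ1 hκθ hstab hU'b hU''b hU₃b ψ₀ h k hh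
      hk) m).congr_deriv
    (H_fderiv_apply hΓ hΓop Y hUd hU'd hU''d hU₃c hκ₀ hκ₁ ha hτ hδ hθ1 hκθ hstab hU'b hU''b hU₃b ψ₀ h k hh hk m)
  have hφ := (hasDerivAt_along_line (hasFDerivAt_Phi_scalar hΓ hΓop Y hUd hU'd hU''d hU₃d hU₄c hκ₀ hκ₁ ha hτ hδ hθ1 hκθ hstab hU'b hU''b hU₃b hU₄b ψ₀
      hh hk hl) m).congr_deriv
    (Phi_fderiv_apply hΓ hΓop Y hUd hU'd hU''d hU₃d hU₄c hκ₀ hκ₁ ha hτ hδ hθ1 hκθ hstab hU'b hU''b hU₃b hU₄b ψ₀ hh hk hl m)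
  have hc := hasDerivAt_third_form_combination hz hgh hgk hgl hhkl hhhl hhhk hφ (by simpa only [zero_smul, add_zero] using hz0)
  simp only [zero_smul, add_zero] at hc
  exact hc

end TheEnd

/-! ## §3. Toy -/

/-- Toy (§1 with every function constant `1`): the derivative of `1 + 1 + 1 + (1 + (−2)(−1)) = 6` is `0`. -/
example : HasDerivAt (fun s : ℝ => ((1 : ℝ))⁻¹ * 1 + ((1 : ℝ) ^ 2)⁻¹ * 1 * 1 + ((1 : ℝ) ^ 2)⁻¹ * 1 * 1 + (((1 : ℝ) ^ 2)⁻¹ * 1 + -2 / (1 : ℝ) ^ 3 * -1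
    * 1) * 1 + 0 * s)
    0 0 := by
  have h := ((hasDerivAt_id (0 : ℝ)).const_mul (0 : ℝ)).const_add
    (((1 : ℝ))⁻¹ * 1 + ((1 : ℝ) ^ 2)⁻¹ * 1 * 1 + ((1 : ℝ) ^ 2)⁻¹ * 1 * 1 + (((1 : ℝ) ^ 2)⁻¹ * 1 + -2 / (1 : ℝ) ^ 3 * -1 * 1) * 1)
  simpa using h

end Summit.QuantumFields.BalabanUV.T4Continuum.NE7b.SupFourthDerivativeRaw

end
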